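import Literature.AlgebraicGeometry.Frobenioids.PadicFrobenioidRelTop
import Literature.AlgebraicGeometry.Frobenioids.PadicKummerThm24iFrobenioidRelOfEquivalenceHfs
import HarnessLib

/-!
# Frobenioids II, Theorem 2.4 (i) over the ABSOLUTE bases `CosetCat Πᵢ` from an equivalence `Ψ` alone, with the clause
# «`Φ₁` is fieldwise saturated if and only if `Φ₂` is» PROVED — modulo map_H only

Mochizuki, *The geometry of Frobenioids II*, Kyushu J. Math. **62** (2008) 401–460, §2, Theorem 2.4 (i) pp. 19–20
[cite: MochizukiFrdII2008, Thm 2.4 (i) p.19]: "Assume that this isomorphism `G₁ ⥲ G₂` maps `H₁` onto `H₂`. Then … (i) `Φ₁`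
is fieldwise saturated if and only if `Φ₂` is. Moreover, `p₁ = p₂`; `Ψ` … induces isomorphisms … compatible with the
respective Kummer and reciprocity maps".

PROOF-ONLY (cell abc-iut, row «T24ii-JUNCTION», seat abc-iut-L1-t7 gen 7; the `hfs` half of the F1 corollary, split from
`PadicFrobenioidRelTop.lean` only for the olean dependency on abc-iut-L1-t10's `PadicKummerThm24iFrobenioidRelOfEquivalenceHfs`):
* `PadicKummer.Def22Context.thm24i_ofEquivalenceAbs_hfs` — `thm24i_ofEquivalenceAbs` (F1) with `fsᵢ := dᵢ.IsFieldwiseSaturated` and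
  `hfs` := abc-iut-L1-t10's `isFieldwiseSaturated_iff_of_equivalence_temperedBase` ([FrdI] Cor. 4.10/4.11 + Thm. 5.2 (ii)
  transport, abc-iut-w5-d229's transport of (a), (b)) at `Ψ♭ = relTopEquivalence Ψ`, read back through
  `𝓑^temp(Π)⁰ = 𝓑^temp(Π, Π)⁰` (`isFieldwiseSaturated_relTop_iff`; inlined — as a separate head it would restate t10's
  theorem): Theorem 2.4 (i) on abc-iut-w5-d229's data from `Ψ` alone modulo EXACTLY the printed assumption `map_H`.
Nothing of [FrdI]/[FrdII] is re-typed; nothing here concerns [IUTchIII].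
-/

noncomputable section

namespace Literature.AlgebraicGeometry.Frobenioids

open CategoryTheory Field IntermediateField Kummer Function
open Literature.NumberTheory.GaloisRepresentations
open Literature.AnabelianGeometry.SemiGraphs QuasiTemperoid PadicFrd PadicFrd.Datum PadicFrd.Datum.GaloisChart PadicFrd.RelGal

/-! ### Theorem 2.4 (i) over the absolute bases, modulo map_H only -/

namespace PadicKummer.Def22Context

variable {p₁ p₂ : ℕ} [Fact p₁.Prime] [Fact p₂.Prime]
  {P₁ : Type} [Group P₁] [TopologicalSpace P₁] [IsTopologicalGroup P₁] [SecondCountableTopology P₁] (hP₁ : IsTempered P₁)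
  (hZ₁ : IsSlimGroup P₁) {φ₁ : P₁ →* GalFbar ℚ_[p₁]} {hφ₁ : IsOpenHom φ₁}
  {d₁ : PadicFrd.Datum (CosetCat P₁) p₁}
  (hd₁ : d₁.base = CosetCat.push φ₁ hφ₁.isOpenMap ⋙ CosetCat.toConnected (isTempered_galFbar ℚ_[p₁]) ⋙ galoisPadicFields p₁)
  {P₂ : Type} [Group P₂] [TopologicalSpace P₂] [IsTopologicalGroup P₂] (hP₂ : IsTempered P₂) (hZ₂ : IsSlimGroup P₂)
  {φ₂ : P₂ →* GalFbar ℚ_[p₂]} {hφ₂ : IsOpenHom φ₂}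
  {d₂ : PadicFrd.Datum (CosetCat P₂) p₂}
  (hd₂ : d₂.base = CosetCat.push φ₂ hφ₂.isOpenMap ⋙ CosetCat.toConnected (isTempered_galFbar ℚ_[p₂]) ⋙ galoisPadicFields p₂)
  (Ψ : d₁.frobenioid ≌ d₂.frobenioid)
  {A₁ : d₁.frobenioid} (hA₁ : A₁.base.sg.toSubgroup.Normal) (hA₂ : (Ψ.functor.obj A₁).base.sg.toSubgroup.Normal)
  {H₁ : Subgroup (absoluteGaloisGroup (baseFld p₁ φ₁ hφ₁))} [H₁.Normal]
  {hH₁ : IsOpen (H₁ : Set (absoluteGaloisGroup (baseFld p₁ φ₁ hφ₁)))}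
  {H₂ : Subgroup (absoluteGaloisGroup (baseFld p₂ φ₂ hφ₂))} [H₂.Normal]
  {hH₂ : IsOpen (H₂ : Set (absoluteGaloisGroup (baseFld p₂ φ₂ hφ₂)))}
  (map_H : H₁.map (isoGOfEquivalenceRel hP₁ hZ₁ φ₁ hφ₁ (d₁.relTop_base_eq φ₁ hφ₁ hd₁) hP₂ hZ₂ φ₂ hφ₂
    (d₂.relTop_base_eq φ₂ hφ₂ hd₂) (relTopEquivalence Ψ) (d₁.toRelTopFrob.obj A₁)).toMulEquiv.toMonoidHom = H₂)
  (N : ℕ) [NeZero N]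
  (hμ₁ : ∀ ζ : rootsOfUnity N (AlgebraicClosure (baseFld p₁ φ₁ hφ₁)),
    ((ζ : (AlgebraicClosure (baseFld p₁ φ₁ hφ₁))ˣ) : AlgebraicClosure (baseFld p₁ φ₁ hφ₁)) ∈
      objL φ₁ hφ₁ d₁.relTop (d₁.toRelTopFrob.obj A₁))
  (hμ₂ : ∀ ζ : rootsOfUnity N (AlgebraicClosure (baseFld p₂ φ₂ hφ₂)),
    ((ζ : (AlgebraicClosure (baseFld p₂ φ₂ hφ₂))ˣ) : AlgebraicClosure (baseFld p₂ φ₂ hφ₂)) ∈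
      objL φ₂ hφ₂ d₂.relTop (d₂.toRelTopFrob.obj (Ψ.functor.obj A₁)))

/-- **[FrdII] Theorem 2.4 (i) for the `p`-adic Frobenioids over the ABSOLUTE genuine bases `Dᵢ = 𝓑^temp(Πᵢ)⁰` (small model
`CosetCat Πᵢ`, abc-iut-w5-d229's convention) from an EQUIVALENCE `Ψ : C₁ ⥲ C₂` ALONE, with «`Φ₁` fieldwise saturated iff `Φ₂`»
a THEOREM** (`fsᵢ := dᵢ.IsFieldwiseSaturated`, `hfs` := abc-iut-L1-t10's `isFieldwiseSaturated_iff_of_equivalence_temperedBase` at `Ψ♭`) — modulo EXACTLY the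
printed ASSUMPTION `map_H` ("this isomorphism `G₁ ⥲ G₂` maps `H₁` onto `H₂`", for the named representative
`isoGOfEquivalenceRel`). [cite: MochizukiFrdII2008, Thm 2.4 (i) p.19] -/
theorem thm24i_ofEquivalenceAbs_hfs
    (eFN₁ : FN (contextOfObjectAbs φ₁ hφ₁ d₁ hd₁ A₁ hA₁ H₁ hH₁) N ≃+ ZMod N)
    (hc₁ : IsNHSaturated (contextOfObjectAbs φ₁ hφ₁ d₁ hd₁ A₁ hA₁ H₁ hH₁) N) :
    haveI := finiteDimensional_objL φ₁ hφ₁ d₁.relTop (d₁.toRelTopFrob.obj A₁)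
    haveI := normal_objL φ₁ hφ₁ d₁.relTop (d₁.toRelTopFrob.obj A₁) hA₁
    haveI := finiteDimensional_objL φ₂ hφ₂ d₂.relTop (d₂.toRelTopFrob.obj (Ψ.functor.obj A₁))
    haveI := normal_objL φ₂ hφ₂ d₂.relTop (d₂.toRelTopFrob.obj (Ψ.functor.obj A₁)) hA₂
    haveI := finiteDimensional_baseFld p₁ φ₁ hφ₁; haveI := finiteDimensional_baseFld p₂ φ₂ hφ₂
    haveI := locallyCompactSpace_H_contextOfObjectRel φ₁ hφ₁ d₁.relTop (d₁.relTop_base_eq φ₁ hφ₁ hd₁)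
      (d₁.toRelTopFrob.obj A₁) hA₁ H₁ hH₁
    haveI := locallyCompactSpace_H_contextOfObjectRel φ₂ hφ₂ d₂.relTop (d₂.relTop_base_eq φ₂ hφ₂ hd₂)
      (d₂.toRelTopFrob.obj (Ψ.functor.obj A₁)) hA₂ H₂ hH₂
    letI := (galoisChartRel φ₁ hφ₁ d₁.relTop (d₁.relTop_base_eq φ₁ hφ₁ hd₁) (d₁.toRelTopFrob.obj A₁) hA₁).galAction
    letI := (galoisChartRel φ₂ hφ₂ d₂.relTop (d₂.relTop_base_eq φ₂ hφ₂ hd₂)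
      (d₂.toRelTopFrob.obj (Ψ.functor.obj A₁)) hA₂).galAction
    Thm24i (contextOfObjectAbs φ₁ hφ₁ d₁ hd₁ A₁ hA₁ H₁ hH₁) (contextOfObjectAbs φ₂ hφ₂ d₂ hd₂ (Ψ.functor.obj A₁) hA₂ H₂ hH₂)
      N p₁ p₂ d₁.IsFieldwiseSaturated d₂.IsFieldwiseSaturated
      ((isoOfEquivalenceAbs hP₁ hZ₁ hd₁ hP₂ hZ₂ hd₂ Ψ hA₁ hA₂ map_H).thm24Data N)
      ((contextOfObjectAbs φ₁ hφ₁ d₁ hd₁ A₁ hA₁ H₁ hH₁).dualityIsoOfLocalDuality N eFN₁ hc₁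
        (cupDualH_bijective_ofGalois_mlf p₁ (objL φ₁ hφ₁ d₁.relTop (d₁.toRelTopFrob.obj A₁)) H₁ hH₁
          (galoisChartRel φ₁ hφ₁ d₁.relTop (d₁.relTop_base_eq φ₁ hφ₁ hd₁) (d₁.toRelTopFrob.obj A₁) hA₁).res
          (galoisChartRel φ₁ hφ₁ d₁.relTop (d₁.relTop_base_eq φ₁ hφ₁ hd₁) (d₁.toRelTopFrob.obj A₁) hA₁).res_smul
          ((galoisChartRel φ₁ hφ₁ d₁.relTop (d₁.relTop_base_eq φ₁ hφ₁ hd₁) (d₁.toRelTopFrob.obj A₁) hA₁).muModel N hμ₁)))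
      ((contextOfObjectAbs φ₂ hφ₂ d₂ hd₂ (Ψ.functor.obj A₁) hA₂ H₂ hH₂).dualityIsoOfLocalDuality N
        (((isoOfEquivalenceAbs hP₁ hZ₁ hd₁ hP₂ hZ₂ hd₂ Ψ hA₁ hA₂ map_H).isoFN N).symm.trans eFN₁)
        (((isoOfEquivalenceAbs hP₁ hZ₁ hd₁ hP₂ hZ₂ hd₂ Ψ hA₁ hA₂ map_H).isNHSaturated_iff N).mp hc₁)
        (cupDualH_bijective_ofGalois_mlf p₂ (objL φ₂ hφ₂ d₂.relTop (d₂.toRelTopFrob.obj (Ψ.functor.obj A₁))) H₂ hH₂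
          (galoisChartRel φ₂ hφ₂ d₂.relTop (d₂.relTop_base_eq φ₂ hφ₂ hd₂) (d₂.toRelTopFrob.obj (Ψ.functor.obj A₁)) hA₂).res
          (galoisChartRel φ₂ hφ₂ d₂.relTop (d₂.relTop_base_eq φ₂ hφ₂ hd₂)
            (d₂.toRelTopFrob.obj (Ψ.functor.obj A₁)) hA₂).res_smul
          ((galoisChartRel φ₂ hφ₂ d₂.relTop (d₂.relTop_base_eq φ₂ hφ₂ hd₂)
            (d₂.toRelTopFrob.obj (Ψ.functor.obj A₁)) hA₂).muModel N hμ₂))) := by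
  -- «Φ₁ fieldwise saturated iff Φ₂»: abc-iut-L1-t10's theorem at `Ψ♭`, read back through `𝓑^temp(Π)⁰ = 𝓑^temp(Π, Π)⁰`
  have hfs : d₁.IsFieldwiseSaturated ↔ d₂.IsFieldwiseSaturated := by
    rw [← d₁.isFieldwiseSaturated_relTop_iff, ← d₂.isFieldwiseSaturated_relTop_iff]
    exact isFieldwiseSaturated_iff_of_equivalence_temperedBase hP₁ hZ₁ hφ₁ (d₁.relTop_base_eq φ₁ hφ₁ hd₁) hP₂ hZ₂ hφ₂
      (d₂.relTop_base_eq φ₂ hφ₂ hd₂) (relTopEquivalence Ψ)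
  exact thm24i_ofEquivalenceAbs hP₁ hZ₁ hd₁ hP₂ hZ₂ hd₂ Ψ hA₁ hA₂ map_H N hμ₁ hμ₂ d₁.IsFieldwiseSaturated
    d₂.IsFieldwiseSaturated hfs eFN₁ hc₁

end PadicKummer.Def22Context

end Literature.AlgebraicGeometry.Frobenioids

end
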